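import Summits.AtomisticToContinuum.HydrodynamicLimit.Theses.JParityClosure
import Literature.MathematicalPhysics.KineticTheory.CollisionTubeFunctional
import Summits.AtomisticToContinuum.HydrodynamicLimit.Theorems.EvenStressEnskog.Negative.PairFunctionalVanishing
import Summits.AtomisticToContinuum.HydrodynamicLimit.Theorems.EvenStressEnskog.Negative.ContactValueZero

/-!
# Line `rotate-fly-commutator-dlr` for crux `JParityClosure.EvenStressEnskog` (stmt-AtomisticToContinuum-13079)

Skeleton (crux-plan, planner-cruxplan-stmt-AtomisticToContinuum-13079-rotate-fly-commutato-0, 2026-08-16;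
idea card `Cruxes/EvenStressEnskog/Ideas/rotate-fly-commutator-dlr.md`, ideator 3, round 1; triage r1-1 / r1-2 /
r1-3: pass ×3, sharpenings answered in `Lines/rotate-fly-commutator-dlr.md`).  Direction: POSITIVE — the
composition `EvenStressEnskog_of` concludes the crux decl
`Summit.AtomisticToContinuum.HydrodynamicLimit.Theses.JParityClosure.EvenStressEnskog` BY NAME from six registered
stubs (sorry-free itself; the stubs carry the only `sorry`s of the file); `EvenStressEnskog_proof` is the D-0027 §3.3
shape.  Local audit `#h21_check_skeleton`: ok, theorem = `EvenStressEnskog_of`, 6 stubs.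

THE LINE (finite-`N`, in the crux's own frame `∃η₀ ∀profiles ∃σ₀ ∀σ ∀Φ ∀τ … ∀η δ ∃r₀ ∀r<r₀ ∃N₀ ∀N≥N₀`,
`N → ∞` BEFORE `r, κ, ℓ/r → 0` everywhere — Disproof §4/§9).  Write `V_i = v_i − u_r(x_i)` for the velocity of
particle `i` relative to the `r`-mollified empirical velocity at its position (`pecVel`), `ξ_ij = ε⁻¹ sepVec x_i x_j`
for rescaled relative positions (`xi`, the crux's contact-normal convention), `Λ_i = Π_{j≠i} lam(ξ_ij)` for a
smooth LOCAL MARK of the microscale neighbourhood (`lam = 0` within `1+δ` of contact, `= 1` beyond a finite range,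
`IsLocalMark`), and `Γ_i[μ,m] = Σ_{j≠i} μ(ξ_ij) m(V_j) Π_{k≠i,j} lam(ξ_ik)` for the one-neighbour probe sums
(`nbrSum`; `μ = ∂_a lam`, `m ∈ {1, (·)_a}` give the streaming derivative `ε d/ds Λ_i = Σ_a (V_i^a Γ_i[∂_a lam,1] −
Γ_i[∂_a lam,(·)_a])`).  All statistics are `(N+1)⁻¹ ∫₀^τ Σ_i φ(s,x_i) g(σ³ρ_r(x_i)) (…) ds` along the true flow
(`pathStat`), tested in local-Gibbs probability.

* S1 `stub_isoChaos` — THE BET (IsoChaos, tested): the isotropy defect `[Θ(R V_i) − Θ(V_i)]·Γ_i[μ,m]` averages to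
  `0` for every velocity observable `Θ` and neighbour weight `m` of linear growth, every probe `μ`, mark `lam` and
  isometry `R ∈ O(3)` — single-particle conditional isotropy of the peculiar velocity GIVEN the microscale
  neighbourhood (positions AND, to first order, velocities: triage r1-2 (1) / r1-3 (1)).  Number-free,
  equation-of-state-free, MD-measurable; strictly weaker than local equilibrium.
* S2 `stub_microStationarity` — the generator identity (provable now, M–L): `ψ(V_i)·ε dΛ_i/ds` averages to `0`:
  `ε ×` the fundamental theorem of calculus for `H_i = φ g ψ(V_i) Λ_i` along the path (`H_i` has NO jump at `i`'s
  collisions since `Λ_i = 0` there; the jumps of `u_r` at collisions inside the `r`-ball and the macroscopic drift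
  terms are `O(1/r)` per unit time, so the micro term is `O(ε/r)` pathwise on the good set, given kinetic energy).
* S3 `stub_palmInvariance_of` — the LEVER at finite `N` (provable now, M): S1 → S2 → `PalmInvarianceTested`, i.e.
  the DLR-gradient statistic `ψ(V_i)·D_{M V_i}Λ_i` vanishes for EVERY matrix `M`: by the pointwise identity
  `isoSplit` (PROVED below) the isotropy defect of the test functional `K^R = ψ(R⁻¹V_i)·ε dΛ_i/ds` is
  `micro(ψ) + palm(ψ, R − I) − micro(ψ∘R⁻¹)`; S2 kills both micro terms, S1 the defect, and
  `span{R − I : R ∈ SO(3)} = M₃(ℝ)`.  This is the finite-`N`, hard-core, generator-level form of the card's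
  commutator lemma `Φ₋ₜ ∘ ℛ_i(R)⁻¹ ∘ Φ_t ∘ ℛ_i(R) = T_i(t(Rp_i − p_i))` (`commutator_eq_transPos`, PROVED below in
  its ideal-gas global form): velocity isotropy + free flight GENERATE one-particle translations.
* S4 `stub_staticContactLaw` — STATICS (L–XL): Palm + Iso + Micro + Compact ⇒ `TubeLawTested`: the fixed-time
  collision-TUBE statistic of the even marks (tree `tubeTimeStat` at `L = 1`, i.e. UNWEIGHTED) has the Enskog
  value `σ³∫∫χ g Y(σ³ρ_r) B_r`.  Chain: no atom at `V = 0` (LG entropy) ⇒ speed-weighted Palm ⇒ canonical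
  single-move DLR of the time–`χ`-averaged microscale law on path-components of the OPEN allowed cells +
  configuration-independence of the speed law; low-density local unjamming / vacant-set connectivity; canonical →
  grand-canonical (Georgii) + translation invariance of local averages; density pinned by `ρ_r` and PURE (S6);
  low-density uniqueness (Ruelle / Lebowitz–Penrose) ⇒ hard-sphere Gibbs `g_{z(ρ)}` ⇒ contact shell `Y(ρσ³)ρ²`,
  isotropic, with `Y = (3/2π)F′` on the OPEN band via HsEosLowDensity's analytic `F` (Disproof §3/§5,
  `ContactValueZero`); velocities at contact: configuration-independent two-body law with zero cross-covariance
  (Iso) and the exchange-symmetric halving `∫a₊² = ½∫a²` (Disproof §10 `Theta_XiP_eq_half`: the Enskog side is a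
  quadratic form of `w − v`, second-moment blind) ⇒ both sides `= Y ρ²(4π/15)(2Σ + trΣ·𝟙)`; tube ↔ shell as
  `κ → 0` after `N → ∞`.
* S5 `stub_tubePullback` — BOOKKEEPING (L, shared with 13078's picked S2 `stub_cylinderPullback` at `L = 1` plus a
  velocity-tail input for the unbounded even mark): `K_N[χ g Ξ_P^{kl}] − tubeTimeStat(Ξ_P^{kl}, L = 1, κ) → 0`
  in probability, `N → ∞` then `κ → 0`.
* S6 `stub_densityCompactness` — PURITY in density (shared, isotropy-free; route remark R1 made a stub): no
  density structure between the mesoscale `ℓ ≥ L₀ ε_N/σ` and `r`, tested as an `L¹` modulus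
  `∫∫ g(σ³ρ_r)|ρ_ℓ − ρ_r| → 0`.

Composition `EvenStressEnskog_of h1 … h6`: `hP := h3 h1 h2`, `hT := h4 hP h1 h2 h6`, then the crux (named form
`evenStressEnskog_iff`, `Iff.rfl`) from `hT` and `h5` by the union bound
`{η < |K − E|} ⊆ {η/2 < |K − T|} ∪ {η/2 < |T − E|}` with `η₀, σ₀, r₀ := min`, `κ := min(κ₀⁴, κ₀⁵)/2`,
`N₀ := max` (kernel-checked, sorry-free).

Disproof.lean (cycles 1–2, refuter-cdisprove-…-13079-0 / -g2-0; READ): no `_false_without_<H>` theorem exists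
(§6.2), no `-- Targets` stub kill; honoured: §4/§9 limit ORDER (`r, κ, ℓ` fixed or bounded below by `L₀ε/σ` while
`N → ∞`; imported `Negative.PairFunctionalVanishing`, cited `Negative.SwappedOrderTrivial` — landed p74513, not yet built on the farm at write time), §3/§5 `Y` only on the open
band through HsEosLowDensity's `F` (imported `Negative.ContactValueZero`; the composition uses the crux's `Y`
verbatim and never evaluates it), §8/§10 the trace of the line's output is the impulse-rate law and the target
form is the h-blind quadratic form (S4), §6.4(b) the would-be killer "Maxwellian one-body + non-Enskog J-even
contact law" must violate S1 (named symmetry) or S6 (density mixture).  Negatives index (12): no stub restates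
9168 (∀-solution frame), 9236/9238 (small cells: here `ℓ ≥ L₀ε/σ` carries `≥ cL₀³` particles and `N → ∞` first),
14607 (exponential tails: unused).  Every stub keeps the crux's frame, tied to local Gibbs data.
-/

set_option linter.unusedVariables false

noncomputable section

namespace Summit.AtomisticToContinuum.HydrodynamicLimit.Cruxes.EvenStressEnskog.RotateFlyCommutatorDlr

open scoped BigOperators InnerProductSpace Topology ENNReal
open MeasureTheory Filter Set
open Literature.MathematicalPhysics.KineticTheory Literature.Analysis.FluidPDE
open Summit.AtomisticToContinuum.HydrodynamicLimit.Theses.JParityClosure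

/-! ## §0 The crux's objects, named (verbatim `let`-bodies; same names as `Disproof.lean` §1) -/

/-- Velocity space `ℝ³`. [folklore] -/
abbrev E3 : Type := EuclideanSpace ℝ (Fin 3)

/-- The torus geometry of the crux. [folklore] -/
abbrev G3 : Geometry (Fin 3) T3 := Torus.geometry (Fin 3)

/-- The J-even collisional momentum-transfer mark `Ξ_P^{kl}(n,v,w) = ((w−v)·n)₊ n_k n_l` (verbatim `ΞP`).
[folklore] -/
def XiP (k l : Fin 3) (q : E3 × E3 × E3) : ℝ :=
  max ⟪q.2.2 - q.2.1, q.1⟫_ℝ 0 * (q.1 k * q.1 l)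

/-- The thermodynamic contact value `Y(a) = (3/2π)·f_ex′(a)` (verbatim the crux's `Y`; `deriv` junk `0` at `a = 0`,
Disproof §3 / `Negative.ContactValueZero` — never evaluated by this file). [folklore] -/
def Y (a : ℝ) : ℝ := 3 / (2 * Real.pi) * deriv hsExcessFreeEnergy a

/-- The cone mollifier `b_r(x,y) = 3/(πr³)·(1 − dist(x,y)/r)₊` (verbatim `bx`). [folklore] -/
def bx (r : ℝ) (x y : T3) : ℝ :=
  3 / (Real.pi * r ^ 3) * max (1 - Torus.euclidDist x y / r) 0

/-- The sphere-integrated mark `Θ Ξ v w = ∫ Ξ(ω,v,w)((w−v)·ω)₊ dω` (verbatim `Θ`). [folklore] -/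
def Theta (Ξ : E3 × E3 × E3 → ℝ) (v w : E3) : ℝ :=
  ∫ ω : Metric.sphere (0 : E3) 1, Ξ ((ω : E3), v, w) * hardSphereKernel (w, v) ω ∂sphereMeasure

/-- The `r`-mollified empirical density `ρ_r(x₀)` of a configuration (verbatim `ρm`). [folklore] -/
def rhoM {N : ℕ} (r : ℝ) (z : Config N (Fin 3) T3) (x₀ : T3) : ℝ :=
  ∫ q, bx r q.1 x₀ ∂(empiricalMeasure z)

/-- The `r`-mollified pair functional `B_r Ξ (x₀) = ∫∫ b_r b_r Θ dμ_z dμ_z` (verbatim `B`). [folklore] -/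
def Bfun {N : ℕ} (r : ℝ) (Ξ : E3 × E3 × E3 → ℝ) (z : Config N (Fin 3) T3) (x₀ : T3) : ℝ :=
  ∫ p, bx r p.1.1 x₀ * bx r p.2.1 x₀ * Theta Ξ p.1.2 p.2.2
    ∂((empiricalMeasure z).prod (empiricalMeasure z))

/-- Pre-collisional velocities read off the (right-continuous) configuration (verbatim `pv`). [folklore] -/
def pv {N : ℕ} (z : Config N (Fin 3) T3) (i j : Fin N) : E3 × E3 :=
  reflectVel (G3.sepVec (z i).1 (z j).1) ((z i).2, (z j).2)

/-- The normalised collision functional `K_N[Fn]` along a family of paths (verbatim `Kc`). [folklore] -/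
def Kc {N : ℕ} (ε τ : ℝ) (γ : Config (N + 1) (Fin 3) T3 → ℝ → Config (N + 1) (Fin 3) T3)
    (Fn : Config (N + 1) (Fin 3) T3 → ℝ → Fin (N + 1) → Fin (N + 1) → ℝ)
    (z : Config (N + 1) (Fin 3) T3) : ℝ :=
  ε / (N + 1 : ℝ) * ∑ᶠ (s : ℝ) (_ : s ∈ collisionTimes G3 ε (γ z) ∩ Set.Icc 0 τ),
    ∑ i : Fin (N + 1), ∑ j : Fin (N + 1),
      (if i ≠ j ∧ ‖G3.sepVec (γ z s i).1 (γ z s j).1‖ = ε then Fn z s i j else 0)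

/-- The crux's collision functional `K_N[χ g(σ³ρ_r) Ξ]` for one `N` and one flow (the minuend of the crux's `Dm`,
verbatim). [folklore] -/
def collStat (σ : ℝ) (N : ℕ) (Φ : HardSphereFlow G3 (hsDiameter σ N) (N + 1)) (τ : ℝ)
    (χ : ℝ × T3 → ℝ) (g : ℝ → ℝ) (Ξ : E3 × E3 × E3 → ℝ) (r : ℝ)
    (z : Config (N + 1) (Fin 3) T3) : ℝ :=
  let ε := hsDiameter σ N
  let γ := fun z (s : ℝ) => Φ.flow s z
  Kc ε τ γ (fun z s i j => χ (s, (γ z s i).1) * g (σ ^ 3 * rhoM r (γ z s) (γ z s i).1) *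
    Ξ (ε⁻¹ • G3.sepVec (γ z s i).1 (γ z s j).1, (pv (γ z s) i j).1, (pv (γ z s) i j).2)) z

/-- The crux's Enskog prediction `σ³ ∫₀^τ∫ χ g(σ³ρ_r) Y(σ³ρ_r) B_r dx ds` for one `N` and one flow (the
subtrahend of the crux's `Dm`, verbatim). [folklore] -/
def enskogTerm (σ : ℝ) (N : ℕ) (Φ : HardSphereFlow G3 (hsDiameter σ N) (N + 1)) (τ : ℝ)
    (χ : ℝ × T3 → ℝ) (g : ℝ → ℝ) (Ξ : E3 × E3 × E3 → ℝ) (r : ℝ)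
    (z : Config (N + 1) (Fin 3) T3) : ℝ :=
  let γ := fun z (s : ℝ) => Φ.flow s z
  σ ^ 3 * ∫ s in Set.Icc (0 : ℝ) τ, ∫ x : T3,
    χ (s, x) * g (σ ^ 3 * rhoM r (γ z s) x) * Y (σ ^ 3 * rhoM r (γ z s) x) * Bfun r Ξ (γ z s) x

/-- The crux with the named pieces (same quantifier prefix, body `|collStat − enskogTerm|`). [folklore] -/
def EvenStressEnskogNamed : Prop :=
  ∃ η₀ : ℝ, 0 < η₀ ∧ ∀ (a₀ θ₀ : T3 → ℝ) (u₀ : T3 → V3), Continuous a₀ → Continuous θ₀ →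
    Continuous u₀ → (∀ x, 0 < a₀ x) → (∀ x, 0 < θ₀ x) → ∃ σ₀ : ℝ, 0 < σ₀ ∧ ∀ σ : ℝ, 0 < σ →
    σ < σ₀ → ∀ Φ : (N : ℕ) → HardSphereFlow G3 (hsDiameter σ N) (N + 1), ∀ τ : ℝ, 0 < τ →
    ∀ χ : ℝ × T3 → ℝ, Continuous χ → ∀ g : ℝ → ℝ, Continuous g → (∀ a, η₀ ≤ a → g a = 0) →
    ∀ η δ : ℝ, 0 < η → 0 < δ → ∃ r₀ : ℝ, 0 < r₀ ∧ ∀ r : ℝ, 0 < r → r < r₀ → ∃ N₀ : ℕ,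
    ∀ N : ℕ, N₀ ≤ N → ∀ k l : Fin 3,
      localGibbsLaw σ a₀ u₀ θ₀ N (Φ N)
        {z | η < |collStat σ N (Φ N) τ χ g (XiP k l) r z - enskogTerm σ N (Φ N) τ χ g (XiP k l) r z|}
        ≤ ENNReal.ofReal δ

/-- The crux IS the named statement (definitional unfolding of its `let`-chain; `Iff.rfl`). [folklore] -/
theorem evenStressEnskog_iff : EvenStressEnskog ↔ EvenStressEnskogNamed := Iff.rfl

/-! ## §1 Microscale vocabulary of the line -/

/-- The `r`-mollified empirical momentum `m_r(x₀) = ∫ b_r(x,x₀) v dμ_z`. [folklore] -/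
def momM {N : ℕ} (r : ℝ) (z : Config N (Fin 3) T3) (x₀ : T3) : E3 :=
  ∫ q, bx r q.1 x₀ • q.2 ∂(empiricalMeasure z)

/-- The `r`-mollified empirical velocity `u_r = m_r / ρ_r` (junk `0` where `ρ_r = 0`; at a particle position
`ρ_r ≥ 3/(πr³(N+1)) > 0`, `self_le_mollifiedDensity`). [folklore] -/
def velM {N : ℕ} (r : ℝ) (z : Config N (Fin 3) T3) (x₀ : T3) : E3 :=
  (rhoM r z x₀)⁻¹ • momM r z x₀

/-- The peculiar velocity of particle `i`: `V_i = v_i − u_r(x_i)` (velocity relative to the empirical local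
frame of its own `r`-ball). [folklore] -/
def pecVel {N : ℕ} (r : ℝ) (z : Config N (Fin 3) T3) (i : Fin N) : E3 :=
  (z i).2 - velM r z (z i).1

/-- The rescaled relative position `ξ_ij = ε⁻¹ sepVec x_i x_j` (the crux's contact-normal convention: at a contact
of `(i,j)` it is the unit normal `n̂` the mark `Ξ_P` is read at; moving particle `i` by `εu` shifts every `ξ_ij`
by `+u`; free flight: `d/ds ξ_ij = ε⁻¹(v_i − v_j)`). [folklore] -/
def xi {N : ℕ} (ε : ℝ) (z : Config N (Fin 3) T3) (i j : Fin N) : E3 :=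
  ε⁻¹ • G3.sepVec (z i).1 (z j).1

/-- Partial derivative of a mark profile in the coordinate direction `a`. [folklore] -/
def pd (lam : E3 → ℝ) (a : Fin 3) (ξ : E3) : ℝ :=
  fderiv ℝ lam ξ (EuclideanSpace.single a 1)

/-- The one-neighbour probe sum with local mark, centred at `c`:
`Γ_i[μ, m] = Σ_{j ≠ i} μ(ξ_ij) m(v_j − c) Π_{k ≠ i, j} lam(ξ_ik)`. [folklore] -/
def nbrSum {N : ℕ} (ε : ℝ) (μ : E3 → ℝ) (m : E3 → ℝ) (lam : E3 → ℝ) (c : E3)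
    (z : Config N (Fin 3) T3) (i : Fin N) : ℝ :=
  ∑ j ∈ Finset.univ.erase i, μ (xi ε z i j) * m ((z j).2 - c) *
    ∏ k ∈ (Finset.univ.erase i).erase j, lam (xi ε z i k)

/-- **Micro streaming observable**: `ψ(V_i) · ε dΛ_i/ds` along free flight, `Λ_i = Π_{j≠i} lam(ξ_ij)`, written
out as `ψ(V_i) Σ_a (V_i^a Γ_i[∂_a lam, 1] − Γ_i[∂_a lam, (·)_a])` (`v_i − v_j = V_i − V_j`, same centre).
[folklore] -/
def microObs {N : ℕ} (ε r : ℝ) (ψ : E3 → ℝ) (lam : E3 → ℝ) (z : Config N (Fin 3) T3) (i : Fin N) : ℝ :=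
  ψ (pecVel r z i) * ∑ a : Fin 3,
    ((pecVel r z i) a * nbrSum ε (pd lam a) (fun _ => 1) lam (velM r z (z i).1) z i
      - nbrSum ε (pd lam a) (fun V => V a) lam (velM r z (z i).1) z i)

/-- **Palm-gradient (DLR) observable**: `ψ(V_i) · D_{M V_i} Λ_i = ψ(V_i) Σ_a (M V_i)^a Γ_i[∂_a lam, 1]` — the
derivative of the local mark under displacing particle `i` alone by `ε M V_i`. [folklore] -/
def palmObs {N : ℕ} (ε r : ℝ) (ψ : E3 → ℝ) (lam : E3 → ℝ) (M : E3 →L[ℝ] E3)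
    (z : Config N (Fin 3) T3) (i : Fin N) : ℝ :=
  ψ (pecVel r z i) * ∑ a : Fin 3,
    (M (pecVel r z i)) a * nbrSum ε (pd lam a) (fun _ => 1) lam (velM r z (z i).1) z i

/-- **Isotropy-defect observable**: `[Θ(R V_i) − Θ(V_i)] · Γ_i[μ, m]` — the change of the product test functional
`Θ(V_i)·Σ_j μ(ξ_ij) m(V_j) Π_k lam(ξ_ik)` under the isometry `R` applied to particle `i`'s peculiar velocity ALONE.
[folklore] -/
def isoObs {N : ℕ} (ε r : ℝ) (Θ μ m lam : E3 → ℝ) (R : E3 ≃ₗᵢ[ℝ] E3)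
    (z : Config N (Fin 3) T3) (i : Fin N) : ℝ :=
  (Θ (R (pecVel r z i)) - Θ (pecVel r z i)) * nbrSum ε μ m lam (velM r z (z i).1) z i

/-- The time-averaged, `φ(s,x_i) g(σ³ρ_r(x_i))`-weighted per-particle statistic along the flow:
`(N+1)⁻¹ ∫_{s∈[0,τ]} Σ_i φ g F(z_s) i ds` (Bochner; junk `0` if non-integrable — integrable on good orbits for
the bounded observables below, S2/S3 provers show it). [folklore] -/
def pathStat (σ : ℝ) (N : ℕ) (Φ : HardSphereFlow G3 (hsDiameter σ N) (N + 1)) (τ r : ℝ)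
    (φ : ℝ → T3 → ℝ) (g : ℝ → ℝ) (F : Config (N + 1) (Fin 3) T3 → Fin (N + 1) → ℝ)
    (z : Config (N + 1) (Fin 3) T3) : ℝ :=
  ((N : ℝ) + 1)⁻¹ * ∫ s in Set.Icc (0 : ℝ) τ, ∑ i : Fin (N + 1),
    φ s (Φ.flow s z i).1 * g (σ ^ 3 * rhoM r (Φ.flow s z) (Φ.flow s z i).1) * F (Φ.flow s z) i

/-! ### Test classes -/

/-- Admissible LOCAL MARK profile: `C¹`, vanishing within `1 + δ` of contact (so `Λ_i = 0` at `i`'s collisions and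
small shifts of `i` stay in the open allowed cell), identically `1` beyond a finite range (finite product by
packing). [folklore] -/
def IsLocalMark (lam : E3 → ℝ) : Prop :=
  ContDiff ℝ 1 lam ∧ (∃ δ : ℝ, 0 < δ ∧ ∀ ξ : E3, ‖ξ‖ ≤ 1 + δ → lam ξ = 0) ∧
    ∃ Rm : ℝ, ∀ ξ : E3, Rm ≤ ‖ξ‖ → lam ξ = 1

/-- Admissible one-neighbour PROBE: continuous, compactly supported, vanishing within `1 + δ` of contact
(`∂_a lam` of a local mark is one). [folklore] -/
def IsProbe (μ : E3 → ℝ) : Prop :=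
  Continuous μ ∧ HasCompactSupport μ ∧ ∃ δ : ℝ, 0 < δ ∧ ∀ ξ : E3, ‖ξ‖ ≤ 1 + δ → μ ξ = 0

/-- Velocity weight for the streaming identity: `C¹`, bounded with bounded derivative (closed under `ψ ↦ ψ ∘ R⁻¹`).
[folklore] -/
def IsVelWeight (ψ : E3 → ℝ) : Prop :=
  ContDiff ℝ 1 ψ ∧ ∃ C : ℝ, ∀ V : E3, |ψ V| ≤ C ∧ ‖fderiv ℝ ψ V‖ ≤ C

/-- Continuous functions of at most linear growth (the velocity observables `Θ` and neighbour weights `m` of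
IsoChaos: includes `ψ(R⁻¹V)V^a`, `ψ∘R⁻¹`, `1`, `(·)^a`). [folklore] -/
def IsLinGrowth (Θ : E3 → ℝ) : Prop :=
  Continuous Θ ∧ ∃ C : ℝ, ∀ V : E3, |Θ V| ≤ C * (1 + ‖V‖)

/-- Smooth density cutoff vanishing on `[η₀, ∞)` (the crux's continuous `g` is reached by uniform approximation
inside S4). [folklore] -/
def IsCutoff (η₀ : ℝ) (g : ℝ → ℝ) : Prop :=
  ContDiff ℝ 1 g ∧ ∀ a, η₀ ≤ a → g a = 0

/-! ## §2 The lever, kernel-checked -/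

/-- Phase space of `n` labelled point particles in `ℝ³` (positions, momenta) — the ideal-gas, hole-free setting of
the commutator lemma. [folklore] -/
abbrev Phase (n : ℕ) : Type := (Fin n → E3) × (Fin n → E3)

/-- Free flight for time `t`. [folklore] -/
def freeFl {n : ℕ} (t : ℝ) (z : Phase n) : Phase n := (z.1 + t • z.2, z.2)

/-- Apply a map `g` to the momentum of particle `i` alone. [folklore] -/
def rotMom {n : ℕ} (i : Fin n) (g : E3 → E3) (z : Phase n) : Phase n :=
  (z.1, Function.update z.2 i (g (z.2 i)))

/-- Translate the position of particle `i` alone by `d`. [folklore] -/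
def transPos {n : ℕ} (i : Fin n) (d : E3) (z : Phase n) : Phase n :=
  (Function.update z.1 i (z.1 i + d), z.2)

/-- **Rotate, fly, unrotate, fly back = translate one particle** (the card's lever; re-proved here, as by all three
triagers): `Φ₋ₜ ∘ ℛ_i(g′) ∘ Φ_t ∘ ℛ_i(g) = T_i(t(g p_i − p_i))` whenever `g′(g p_i) = p_i` — nothing else moves.
With `g` ranging over `SO(3)` and `t` over a neighbourhood of `0`, `t(gp_i − p_i)` reaches every direction not
`⊥ p_i` (two moves reach the rest), so invariance under free flight and single-momentum rotations gives invariance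
under single-particle translations: canonical DLR.  With hard cores the identity holds on
{particle `i` collision-free on `[0,t]` in both branches}; the line uses its GENERATOR form (`isoSplit` + S2),
which needs no finite displacement (triage r1-3 (ii)). [folklore] -/
theorem commutator_eq_transPos {n : ℕ} (i : Fin n) (g g' : E3 → E3) (t : ℝ) (z : Phase n)
    (hg : g' (g (z.2 i)) = z.2 i) :
    freeFl (-t) (rotMom i g' (freeFl t (rotMom i g z))) = transPos i (t • (g (z.2 i) - z.2 i)) z := by
  obtain ⟨q, p⟩ := z
  simp only at hg
  refine Prod.ext ?_ ?_
  · funext j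
    simp only [freeFl, rotMom, transPos, Pi.add_apply, Pi.smul_apply, Pi.neg_apply, neg_smul,
      Function.update_self, hg]
    by_cases hj : j = i
    · subst hj
      simp only [Function.update_self, smul_sub]
      abel
    · simp only [Function.update_of_ne hj]
      abel
  · funext j
    simp only [freeFl, rotMom, transPos, Function.update_self, hg]
    by_cases hj : j = i
    · subst hj
      simp only [Function.update_self]
    · simp only [Function.update_of_ne hj]

/-- Corollary: a function invariant under free flight and under the two momentum maps of particle `i` is invariant
under the translation of particle `i` by `t(g p_i − p_i)`. [folklore] -/
theorem invariant_transPos {n : ℕ} {α : Type*} (f : Phase n → α) (i : Fin n) (g g' : E3 → E3)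
    (hff : ∀ t z, f (freeFl t z) = f z) (hg : ∀ z, f (rotMom i g z) = f z)
    (hg' : ∀ z, f (rotMom i g' z) = f z) (t : ℝ) (z : Phase n) (hinv : g' (g (z.2 i)) = z.2 i) :
    f (transPos i (t • (g (z.2 i) - z.2 i)) z) = f z := by
  rw [← commutator_eq_transPos i g g' t z hinv, hff, hg', hff, hg]

/-- **The finite-`N` shadow of the commutator (S3's algebraic core), PROVED.** For every configuration,
particle, velocity weight `ψ`, mark profile `lam` and isometry `R`:
`Σ_a Δ_R[ψ(R⁻¹·)(·)_a ; ∂_a lam, 1] − Σ_a Δ_R[ψ∘R⁻¹ ; ∂_a lam, (·)_a]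
  = micro(ψ) + palm(ψ, R − I) − micro(ψ ∘ R⁻¹)`,
where `Δ_R[Θ; μ, m] = isoObs … Θ μ m lam R` is the isotropy defect of the product test functional
`Θ(V_i) · Σ_j μ(ξ_ij) m(V_j) Π_k lam(ξ_ik)`: the left side is the isotropy defect of the test functional
`K^R(V) = ψ(R⁻¹V) · ε dΛ_i/ds`, expanded into six product instances of S1.  So once the two micro terms vanish
(S2) and the six defects vanish (S1), the Palm-gradient statistic with velocity weight `ψ(V_i)((R−I)V_i)`
vanishes — for every `R ∈ O(3)`, hence (span) for every matrix. [folklore] -/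
theorem isoSplit {N : ℕ} (ε r : ℝ) (ψ lam : E3 → ℝ) (R : E3 ≃ₗᵢ[ℝ] E3)
    (z : Config N (Fin 3) T3) (i : Fin N) :
    (∑ a : Fin 3, isoObs ε r (fun V => ψ (R.symm V) * V a) (pd lam a) (fun _ => 1) lam R z i)
      - ∑ a : Fin 3, isoObs ε r (ψ ∘ R.symm) (pd lam a) (fun V => V a) lam R z i
    = microObs ε r ψ lam z i
      + palmObs ε r ψ lam
          (((R.toContinuousLinearEquiv : E3 ≃L[ℝ] E3) : E3 →L[ℝ] E3) - ContinuousLinearMap.id ℝ E3) z i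
      - microObs ε r (ψ ∘ R.symm) lam z i := by
  simp only [isoObs, microObs, palmObs, Function.comp_apply, LinearIsometryEquiv.symm_apply_apply,
    sub_apply, ContinuousLinearMap.id_apply, ContinuousLinearEquiv.coe_coe,
    LinearIsometryEquiv.coe_toContinuousLinearEquiv, PiLp.sub_apply]
  rw [Finset.mul_sum, Finset.mul_sum, Finset.mul_sum, ← Finset.sum_sub_distrib,
    ← Finset.sum_add_distrib, ← Finset.sum_sub_distrib]
  refine Finset.sum_congr rfl fun a _ => ?_
  ring

/-! ## §3 The six registered stubs (each: the statement `Prop` `Stubs.stub_*`, then the sorried theorem `stub_*`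
with the same text; S3 and S4 are implications whose hypotheses are the other stubs' `Prop`s by name) -/

/-- **S1 · ISOCHAOS — THE BET** (`stub_isoChaos`; hardest, load-bearing, the only stub that is a
local-equilibrium-type statement).  In the crux's frame (`∃η₀`, continuous positive local-Gibbs profiles, `∃σ₀`,
any flows, `τ`), for every smooth space–time weight `φ`, smooth cutoff `g` vanishing on `[η₀,∞)`, velocity
observable `Θ` and neighbour weight `m` of linear growth, one-neighbour probe `μ` (vanishing within `1+δ` of
contact), local mark `lam` and isometry `R ∈ O(3)`:  `∀η δ ∃r₀ ∀r<r₀ ∃N₀ ∀N≥N₀`,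
`P_LG( |(N+1)⁻¹∫₀^τ Σ_i φ g(σ³ρ_r(x_i)) [Θ(R V_i) − Θ(V_i)]·Σ_{j≠i} μ(ξ_ij) m(V_j) Π_{k≠i,j} lam(ξ_ik) ds| > η ) ≤ δ`
with `V_· = v_· − u_r(s, x_i(s))` (ALL velocities of the functional referred to the empirical local frame of
particle `i`'s `r`-ball).  Informally: along the true dynamics from local Gibbs data, the time–space-averaged
microscale law around a typical particle is invariant under rotating / reflecting THAT particle's peculiar velocity
alone, JOINTLY given its neighbourhood configuration and (to first order) its neighbours' velocities — tested
single-particle conditional isotropy.  Why plausibly true: it is an OUTPUT of local equilibrium (the Gibbs state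
boosted to `ū` is `⊗ M_{ū,θ}` in velocities, independent of positions: exactly invariant), but STRICTLY WEAKER —
no independence, no Maxwellian, no product, no number; it constrains only the ANGULAR sector of one velocity
relative to local structure, which ONE collision redistributes, so dynamically generated defects are responses
`O(Kn) = O(N^{-1/3})` (velocity–bond angular correlators, Lutsko1996/2001-type contact anisotropy is `O(shear·Kn)`);
the centring defect `ū − ū_r = O(r)` is why `r₀` precedes `N₀`.  Why it might fail: (a) an `O(1)`-per-particle
velocity–structure ANGULAR correlation sustained over Euler times in some forward local-Gibbs evolution (no
mechanism known; MD kill switch: the card's `C₁, C₂` correlators must decay like `N^{-1/3}`); (b) mesoscopic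
VELOCITY texture between `ε` and `r` surviving `N → ∞` (failure of strong compactness of `u^N` at scale `r`, route
remark R1 — post-shock only; pre-shock it is the LLN the route proves elsewhere), which de-centres `V_i`; (c) dense
pockets are cut off by `g`.  Disproof §6.4(b): the adversary's would-be killer "Maxwellian one-body law + non-Enskog
J-even contact law" must violate THIS statement (or S6) — the named symmetry such a witness has to break.  Size XL
(open; the crux-depth content of the line).  Leans on: tree `localGibbsLaw`, `HardSphereFlow`, `empiricalMeasure`,
`integral_empiricalMeasure`; route supports KineticEnergyTails (stmt-13087, frame: see S5) for the linear-growth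
weights; OllaVaradhanYau1993 §4 (C)–(E) (velocity-uncorrelated ⇒ Gibbs; here the second-moment input is replaced by
rotations), FritzFunakiLebowitz1994 Thm 2.2 ((RS)+(LS) ⇒ Gibbs for anharmonic chains), GurevichSuhov1976,
NachtergaeleYau2003 §2.3; barrier `Literature.Barriers.AtomisticToContinuum.BoltzmannHypothesisBarrierNarrow`
evasion (iii) / scope (b). -/
def Stubs.stub_isoChaos : Prop :=
  ∃ η₀ : ℝ, 0 < η₀ ∧ ∀ (a₀ θ₀ : T3 → ℝ) (u₀ : T3 → V3), Continuous a₀ → Continuous θ₀ → Continuous u₀ →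
    (∀ x, 0 < a₀ x) → (∀ x, 0 < θ₀ x) → ∃ σ₀ : ℝ, 0 < σ₀ ∧ ∀ σ : ℝ, 0 < σ → σ < σ₀ →
    ∀ Φ : (N : ℕ) → HardSphereFlow G3 (hsDiameter σ N) (N + 1), ∀ τ : ℝ, 0 < τ →
    ∀ φ : ℝ → T3 → ℝ, Literature.Analysis.FunctionSpaces.Torus.IsSmoothSpaceTimeOn Set.univ φ →
    ∀ g : ℝ → ℝ, IsCutoff η₀ g →
    ∀ Θ μ m lam : E3 → ℝ, IsLinGrowth Θ → IsProbe μ → IsLinGrowth m → IsLocalMark lam →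
    ∀ R : E3 ≃ₗᵢ[ℝ] E3,
    ∀ η δ : ℝ, 0 < η → 0 < δ → ∃ r₀ : ℝ, 0 < r₀ ∧ ∀ r : ℝ, 0 < r → r < r₀ →
    ∃ N₀ : ℕ, ∀ N : ℕ, N₀ ≤ N →
      localGibbsLaw σ a₀ u₀ θ₀ N (Φ N)
        {z | η < |pathStat σ N (Φ N) τ r φ g (isoObs (hsDiameter σ N) r Θ μ m lam R) z|}
        ≤ ENNReal.ofReal δ

/-- Registered stub S1 (`Stubs.stub_isoChaos`, verbatim): the `sorry` to be discharged. -/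
theorem stub_isoChaos :
  ∃ η₀ : ℝ, 0 < η₀ ∧ ∀ (a₀ θ₀ : T3 → ℝ) (u₀ : T3 → V3), Continuous a₀ → Continuous θ₀ → Continuous u₀ →
    (∀ x, 0 < a₀ x) → (∀ x, 0 < θ₀ x) → ∃ σ₀ : ℝ, 0 < σ₀ ∧ ∀ σ : ℝ, 0 < σ → σ < σ₀ →
    ∀ Φ : (N : ℕ) → HardSphereFlow G3 (hsDiameter σ N) (N + 1), ∀ τ : ℝ, 0 < τ →
    ∀ φ : ℝ → T3 → ℝ, Literature.Analysis.FunctionSpaces.Torus.IsSmoothSpaceTimeOn Set.univ φ →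
    ∀ g : ℝ → ℝ, IsCutoff η₀ g →
    ∀ Θ μ m lam : E3 → ℝ, IsLinGrowth Θ → IsProbe μ → IsLinGrowth m → IsLocalMark lam →
    ∀ R : E3 ≃ₗᵢ[ℝ] E3,
    ∀ η δ : ℝ, 0 < η → 0 < δ → ∃ r₀ : ℝ, 0 < r₀ ∧ ∀ r : ℝ, 0 < r → r < r₀ →
    ∃ N₀ : ℕ, ∀ N : ℕ, N₀ ≤ N →
      localGibbsLaw σ a₀ u₀ θ₀ N (Φ N)
        {z | η < |pathStat σ N (Φ N) τ r φ g (isoObs (hsDiameter σ N) r Θ μ m lam R) z|}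
        ≤ ENNReal.ofReal δ := by
  sorry

/-- **S2 · MICRO-STATIONARITY** (`stub_microStationarity`; the generator identity — deterministic up to a kinetic
energy bound; provable now).  Same frame; for every smooth `φ`, smooth cutoff `g`, velocity weight `ψ` (`C¹`,
bounded with bounded derivative) and local mark `lam`:  `∀η δ ∃r₀ ∀r<r₀ ∃N₀ ∀N≥N₀`,
`P_LG( |(N+1)⁻¹∫₀^τ Σ_i φ g(σ³ρ_r(x_i)) ψ(V_i) · ε dΛ_i/ds ds| > η ) ≤ δ`,
`ε dΛ_i/ds = Σ_a (V_i^a Γ_i[∂_a lam, 1] − Γ_i[∂_a lam, (·)_a]) = Σ_j ∇lam(ξ_ij)·(v_i − v_j) Π_{k≠j} lam(ξ_ik)`.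
Why true (proof sketch): put `H_i(s) = φ(s,x_i) g(σ³ρ_r(s,x_i)) ψ(v_i − u_r(s,x_i)) Λ_i(s)` along a good orbit.
`H_i` has NO jump at the collisions of `i` (`Λ_i ≡ 0` on a time-neighbourhood of each, since `lam = 0` within
`1 + δ` of contact) and positions are continuous at everybody else's; its only jumps come from `u_r(s, x_i)` when a
pair INSIDE the `r`-ball around `x_i` collides (`(N+1)⁻¹(b_r(x_k) − b_r(x_l))Δv = O(ε r⁻⁴|Δv|/(N+1))` each,
`O((N+1)ρ r³)` affected `i` per collision, `O((N+1) N^{1/3})` collisions: total `O(σ³ρ θ τ / r)` after the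
`(N+1)⁻¹`), and between jumps it is absolutely continuous with derivative = macroscopic terms (`∂_sφ + v_i·∇φ`,
`g′σ³ dρ_r/ds`, `∇ψ·du_r/ds`, all `O((1+|v|²)/r)`) `+ ε⁻¹ ×` the micro integrand.  Multiplying the fundamental
theorem of calculus (tree pattern `CollisionalTransferTimeDep.sub_eq_integral_add_finsum_collisionJump_td`) by
`ε (N+1)⁻¹` and summing over `i` gives `|micro statistic| ≤ ε·C(φ,g,ψ,lam,τ)·(1 + KE/(N+1))/r` pathwise on the good
set; the kinetic energy per particle is conserved and tight under the local Gibbs law (Gaussian velocities), and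
`ε = σ(N+1)^{-1/3} → 0`.  This is the `n`-body-mark analogue of the route support EmpiricalEnskogIdentity
(stmt-13086) and of card C's `PairTransportIdentity` (IdeatorOneSketch).  Why it might fail: only through a typing
slip (Bochner junk if the path integrand were non-integrable — it is bounded and piecewise continuous on good orbits;
`u_r` junk where `ρ_r = 0` — never at a particle).  Size M–L.  Leans on: tree `HardSphereFlow.isTrajectory`,
`IsHardSphereTrajectory.{free, locFinite, pos_continuous, eq_freeFlight}`, `freeFlight_apply`,
`Torus.geometry_sepVec`, `CollisionalTransferTimeDep.sub_eq_integral_add_finsum_collisionJump_td`,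
`configEnergy_collidePair`, `configEnergy_freeFlight`, `integral_empiricalMeasure`, `localGibbsLaw_compl_good`
(FrequencyLawReduction), `self_le_mollifiedDensity` (SwappedOrderTrivial); Mathlib `intervalIntegral.integral_eq_sub_of_hasDerivAt`-family,
`Function.update`, `HasCompactSupport`. -/
def Stubs.stub_microStationarity : Prop :=
  ∃ η₀ : ℝ, 0 < η₀ ∧ ∀ (a₀ θ₀ : T3 → ℝ) (u₀ : T3 → V3), Continuous a₀ → Continuous θ₀ → Continuous u₀ →
    (∀ x, 0 < a₀ x) → (∀ x, 0 < θ₀ x) → ∃ σ₀ : ℝ, 0 < σ₀ ∧ ∀ σ : ℝ, 0 < σ → σ < σ₀ →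
    ∀ Φ : (N : ℕ) → HardSphereFlow G3 (hsDiameter σ N) (N + 1), ∀ τ : ℝ, 0 < τ →
    ∀ φ : ℝ → T3 → ℝ, Literature.Analysis.FunctionSpaces.Torus.IsSmoothSpaceTimeOn Set.univ φ →
    ∀ g : ℝ → ℝ, IsCutoff η₀ g →
    ∀ ψ lam : E3 → ℝ, IsVelWeight ψ → IsLocalMark lam →
    ∀ η δ : ℝ, 0 < η → 0 < δ → ∃ r₀ : ℝ, 0 < r₀ ∧ ∀ r : ℝ, 0 < r → r < r₀ →
    ∃ N₀ : ℕ, ∀ N : ℕ, N₀ ≤ N →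
      localGibbsLaw σ a₀ u₀ θ₀ N (Φ N)
        {z | η < |pathStat σ N (Φ N) τ r φ g (microObs (hsDiameter σ N) r ψ lam) z|}
        ≤ ENNReal.ofReal δ

/-- Registered stub S2 (`Stubs.stub_microStationarity`, verbatim): the `sorry` to be discharged. -/
theorem stub_microStationarity :
  ∃ η₀ : ℝ, 0 < η₀ ∧ ∀ (a₀ θ₀ : T3 → ℝ) (u₀ : T3 → V3), Continuous a₀ → Continuous θ₀ → Continuous u₀ →
    (∀ x, 0 < a₀ x) → (∀ x, 0 < θ₀ x) → ∃ σ₀ : ℝ, 0 < σ₀ ∧ ∀ σ : ℝ, 0 < σ → σ < σ₀ →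
    ∀ Φ : (N : ℕ) → HardSphereFlow G3 (hsDiameter σ N) (N + 1), ∀ τ : ℝ, 0 < τ →
    ∀ φ : ℝ → T3 → ℝ, Literature.Analysis.FunctionSpaces.Torus.IsSmoothSpaceTimeOn Set.univ φ →
    ∀ g : ℝ → ℝ, IsCutoff η₀ g →
    ∀ ψ lam : E3 → ℝ, IsVelWeight ψ → IsLocalMark lam →
    ∀ η δ : ℝ, 0 < η → 0 < δ → ∃ r₀ : ℝ, 0 < r₀ ∧ ∀ r : ℝ, 0 < r → r < r₀ →
    ∃ N₀ : ℕ, ∀ N : ℕ, N₀ ≤ N →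
      localGibbsLaw σ a₀ u₀ θ₀ N (Φ N)
        {z | η < |pathStat σ N (Φ N) τ r φ g (microObs (hsDiameter σ N) r ψ lam) z|}
        ≤ ENNReal.ofReal δ := by
  sorry

/-- **Tested reduced-Palm translation invariance** ("tested DLR"; the OUTPUT of the lever, S3's conclusion and
S4's main input): in the same frame, for every smooth `φ`, smooth cutoff `g`, velocity weight `ψ`, local mark `lam`
and EVERY linear map `M`, the DLR-gradient statistic `(N+1)⁻¹∫₀^τ Σ_i φ g ψ(V_i)·D_{M V_i}Λ_i ds` tends to `0`
in probability: the time–`χ`-averaged law of the microscale neighbourhood seen from a typical particle, weighted by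
any `ψ(V_i)(M V_i)`-moment of its peculiar velocity, is invariant under shifting that particle alone inside its open
allowed cell.  Not a stub (it is derived: S3). [folklore] -/
def PalmInvarianceTested : Prop :=
  ∃ η₀ : ℝ, 0 < η₀ ∧ ∀ (a₀ θ₀ : T3 → ℝ) (u₀ : T3 → V3), Continuous a₀ → Continuous θ₀ → Continuous u₀ →
    (∀ x, 0 < a₀ x) → (∀ x, 0 < θ₀ x) → ∃ σ₀ : ℝ, 0 < σ₀ ∧ ∀ σ : ℝ, 0 < σ → σ < σ₀ →
    ∀ Φ : (N : ℕ) → HardSphereFlow G3 (hsDiameter σ N) (N + 1), ∀ τ : ℝ, 0 < τ →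
    ∀ φ : ℝ → T3 → ℝ, Literature.Analysis.FunctionSpaces.Torus.IsSmoothSpaceTimeOn Set.univ φ →
    ∀ g : ℝ → ℝ, IsCutoff η₀ g →
    ∀ ψ lam : E3 → ℝ, IsVelWeight ψ → IsLocalMark lam → ∀ M : E3 →L[ℝ] E3,
    ∀ η δ : ℝ, 0 < η → 0 < δ → ∃ r₀ : ℝ, 0 < r₀ ∧ ∀ r : ℝ, 0 < r → r < r₀ →
    ∃ N₀ : ℕ, ∀ N : ℕ, N₀ ≤ N →
      localGibbsLaw σ a₀ u₀ θ₀ N (Φ N)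
        {z | η < |pathStat σ N (Φ N) τ r φ g (palmObs (hsDiameter σ N) r ψ lam M) z|}
        ≤ ENNReal.ofReal δ

/-- **S3 · THE LEVER AT FINITE `N`** (`stub_palmInvariance_of`; provable now, M): IsoChaos and micro-stationarity
imply tested Palm invariance for every matrix `M`.  Proof sketch: fix the test data and `R ∈ O(3)`; by `isoSplit`
(PROVED above), pointwise in time and `ω`,
`palm(ψ, R − I) = Σ_a Δ_R[ψ(R⁻¹·)(·)_a; ∂_a lam, 1] − Σ_a Δ_R[ψ∘R⁻¹; ∂_a lam, (·)_a] − micro(ψ) + micro(ψ∘R⁻¹)`;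
the eight right-hand statistics are instances of S1 (`Θ = ψ(R⁻¹·)(·)_a` and `ψ∘R⁻¹` have linear growth,
`μ = ∂_a lam` is a probe, `m ∈ {1, (·)_a}`) and of S2 (`ψ∘R⁻¹` is again a velocity weight); `pathStat` is linear in
the observable on good orbits (the integrands are bounded measurable in `s`: measurable flow, finitely many collision
times), so a union bound over eight events at `(η/8, δ/8)` with thresholds `min`/`max` gives the statement for
`M = R − I`; linearity in `M` and `span{R − I : R ∈ SO(3)} = M₃(ℝ)` (π-rotations about the three axes give the
diagonal matrix units, `π/2`- and diagonal-axis π-rotations the off-diagonal ones) give every `M` by one more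
finite union bound.  Why it might fail: it cannot once S1/S2 are read correctly — the only traps are Bochner junk
(handled by proving integrability on good orbits, `localGibbsLaw_compl_good`) and forgetting that all velocities in
`K^R` are centred at the SAME `u_r(x_i)`.  Size M.  Leans on: `isoSplit`, tree `HardSphereFlow.measurable_flow`,
`measurable_piecewise_flow_torus`, `localGibbsLaw_compl_good`; Mathlib `MeasureTheory.integral_add/sub`,
`measure_union_le`, `LinearIsometryEquiv`, `Matrix.toEuclideanLin` / rotations by π (`Real.cos_pi`). -/
def Stubs.stub_palmInvariance_of : Prop :=
  Stubs.stub_isoChaos → Stubs.stub_microStationarity → PalmInvarianceTested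

/-- Registered stub S3 (`Stubs.stub_palmInvariance_of`, hypotheses by name, conclusion verbatim
`PalmInvarianceTested`): the `sorry` to be discharged. -/
theorem stub_palmInvariance_of (hIso : Stubs.stub_isoChaos) (hMicro : Stubs.stub_microStationarity) :
  ∃ η₀ : ℝ, 0 < η₀ ∧ ∀ (a₀ θ₀ : T3 → ℝ) (u₀ : T3 → V3), Continuous a₀ → Continuous θ₀ → Continuous u₀ →
    (∀ x, 0 < a₀ x) → (∀ x, 0 < θ₀ x) → ∃ σ₀ : ℝ, 0 < σ₀ ∧ ∀ σ : ℝ, 0 < σ → σ < σ₀ →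
    ∀ Φ : (N : ℕ) → HardSphereFlow G3 (hsDiameter σ N) (N + 1), ∀ τ : ℝ, 0 < τ →
    ∀ φ : ℝ → T3 → ℝ, Literature.Analysis.FunctionSpaces.Torus.IsSmoothSpaceTimeOn Set.univ φ →
    ∀ g : ℝ → ℝ, IsCutoff η₀ g →
    ∀ ψ lam : E3 → ℝ, IsVelWeight ψ → IsLocalMark lam → ∀ M : E3 →L[ℝ] E3,
    ∀ η δ : ℝ, 0 < η → 0 < δ → ∃ r₀ : ℝ, 0 < r₀ ∧ ∀ r : ℝ, 0 < r → r < r₀ →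
    ∃ N₀ : ℕ, ∀ N : ℕ, N₀ ≤ N →
      localGibbsLaw σ a₀ u₀ θ₀ N (Φ N)
        {z | η < |pathStat σ N (Φ N) τ r φ g (palmObs (hsDiameter σ N) r ψ lam M) z|}
        ≤ ENNReal.ofReal δ := by
  sorry

/-- **S6 · PURITY IN DENSITY — no mesoscale density texture** (`stub_densityCompactness`; isotropy-free, SHARED
currency — route remark R1 of all three triages promoted to a stub).  Same frame; for every continuous nonnegative
cutoff `g` vanishing on `[η₀,∞)`:  `∀ι δ ∃r₀ ∀r<r₀ ∃L₀ ∃N₀ ∀N≥N₀ ∀ℓ ∈ [L₀(N+1)^{-1/3}, r]`,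
`P_LG( ∫₀^τ∫ g(σ³ρ_r(s,x)) |ρ_ℓ(s,x) − ρ_r(s,x)| dx ds > ι ) ≤ δ`: uniformly down to the mesoscale
`ℓ = L₀ ε_N/σ` (balls carrying `≳ L₀³ρ` particles, so sampling noise `O((L₀³ρ)^{-1/2}) < ι` by the choice of `L₀`)
the coarse-grained density has no structure below `r` — an `L¹`-modulus / Kolmogorov–Riesz form of STRONG
precompactness of the empirical density, i.e. the microscale neighbourhoods inside one `r`-ball sample ONE density
`ρ_r(x)` and not a mixture (a Gibbs density-mixture satisfies S1, stationarity and DLR and breaks the crux's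
`ρ_r² Y(σ³ρ_r)` prediction by Jensen — triage r1-1 (2), r1-2 R1, r1-3 remark).  Why plausibly true: automatic from
ANY strong law of large numbers for the density field (pre-shock: classical solution + the `t`-LLN of the conjunct;
in general: BV/shock profiles are strongly compact, isolated discontinuity surfaces cost `O(r)`); macroscopic
gradients contribute `O(ω_ρ(r)) → 0` as `r → 0`, whence `r₀` first.  Why it might fail: persistent mesoscopic
density oscillations (acoustic energy cascading to scales between `N^{-1/6}` and `o(1)`, undamped at Euler scaling)
after blow-up, i.e. a wild/measure-valued scenario for the particle system — for the filed `∀τ` this is a genuine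
extra input (it would be moot if the crux were restricted to `τ < T`, triage R2); phase coexistence is excluded by
the cutoff (`σ³ρ_r < η₀` far below freezing).  Size L (open post-shock, mild).  Leans on: tree `localGibbs_lln`,
`localGibbs_densityLLN`, `empiricalDensityField`, `integral_empiricalMeasure`; Spohn1991 I.3; OllaVaradhanYau1993
(what fixed-time LLNs cost); negatives 9236/9238 respected (`ℓ ≥ L₀ε/σ`, `N → ∞` uniformly in `ℓ`). -/
def Stubs.stub_densityCompactness : Prop :=
  ∃ η₀ : ℝ, 0 < η₀ ∧ ∀ (a₀ θ₀ : T3 → ℝ) (u₀ : T3 → V3), Continuous a₀ → Continuous θ₀ → Continuous u₀ →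
    (∀ x, 0 < a₀ x) → (∀ x, 0 < θ₀ x) → ∃ σ₀ : ℝ, 0 < σ₀ ∧ ∀ σ : ℝ, 0 < σ → σ < σ₀ →
    ∀ Φ : (N : ℕ) → HardSphereFlow G3 (hsDiameter σ N) (N + 1), ∀ τ : ℝ, 0 < τ →
    ∀ g : ℝ → ℝ, Continuous g → (∀ a, η₀ ≤ a → g a = 0) → (∀ a, 0 ≤ g a) →
    ∀ ι δ : ℝ, 0 < ι → 0 < δ → ∃ r₀ : ℝ, 0 < r₀ ∧ ∀ r : ℝ, 0 < r → r < r₀ →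
    ∃ L₀ : ℝ, 0 < L₀ ∧ ∃ N₀ : ℕ, ∀ N : ℕ, N₀ ≤ N →
    ∀ ℓ : ℝ, L₀ * ((N : ℝ) + 1) ^ (-(1 / 3 : ℝ)) ≤ ℓ → ℓ ≤ r →
      localGibbsLaw σ a₀ u₀ θ₀ N (Φ N)
        {z | ι < ∫ s in Set.Icc (0 : ℝ) τ, ∫ x : T3,
            g (σ ^ 3 * rhoM r ((Φ N).flow s z) x) *
              |rhoM ℓ ((Φ N).flow s z) x - rhoM r ((Φ N).flow s z) x|}
        ≤ ENNReal.ofReal δ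

/-- Registered stub S6 (`Stubs.stub_densityCompactness`, verbatim): the `sorry` to be discharged. -/
theorem stub_densityCompactness :
  ∃ η₀ : ℝ, 0 < η₀ ∧ ∀ (a₀ θ₀ : T3 → ℝ) (u₀ : T3 → V3), Continuous a₀ → Continuous θ₀ → Continuous u₀ →
    (∀ x, 0 < a₀ x) → (∀ x, 0 < θ₀ x) → ∃ σ₀ : ℝ, 0 < σ₀ ∧ ∀ σ : ℝ, 0 < σ → σ < σ₀ →
    ∀ Φ : (N : ℕ) → HardSphereFlow G3 (hsDiameter σ N) (N + 1), ∀ τ : ℝ, 0 < τ →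
    ∀ g : ℝ → ℝ, Continuous g → (∀ a, η₀ ≤ a → g a = 0) → (∀ a, 0 ≤ g a) →
    ∀ ι δ : ℝ, 0 < ι → 0 < δ → ∃ r₀ : ℝ, 0 < r₀ ∧ ∀ r : ℝ, 0 < r → r < r₀ →
    ∃ L₀ : ℝ, 0 < L₀ ∧ ∃ N₀ : ℕ, ∀ N : ℕ, N₀ ≤ N →
    ∀ ℓ : ℝ, L₀ * ((N : ℝ) + 1) ^ (-(1 / 3 : ℝ)) ≤ ℓ → ℓ ≤ r →
      localGibbsLaw σ a₀ u₀ θ₀ N (Φ N)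
        {z | ι < ∫ s in Set.Icc (0 : ℝ) τ, ∫ x : T3,
            g (σ ^ 3 * rhoM r ((Φ N).flow s z) x) *
              |rhoM ℓ ((Φ N).flow s z) x - rhoM r ((Φ N).flow s z) x|}
        ≤ ENNReal.ofReal δ := by
  sorry

/-- **The Enskog TUBE LAW** (S4's conclusion; the docking statement shared with card even-rung-mean-variance's
(ME)+(FV) target): in the crux's frame with the crux's CONTINUOUS `χ, g`, `∀η δ ∃r₀ ∀r<r₀ ∃κ₀ ∀κ<κ₀ ∃N₀ ∀N≥N₀ ∀k l`,
the time-integrated fixed-time collision-tube statistic of the even mark `Ξ_P^{kl}` (tree `tubeTimeStat` with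
`ϑ = L = 1`, i.e. weight `min(1 + e^{−F̃}, 1) = 1`: the UNWEIGHTED Boltzmann collision cylinder of flight-time window
`κε`, weight `((N+1)κ)⁻¹`) is within `η` of the crux's Enskog term `σ³∫₀^τ∫ χ g(σ³ρ_r) Y(σ³ρ_r) B_r(Ξ_P^{kl})`
in local-Gibbs probability.  Not a stub (derived: S4). [folklore] -/
def TubeLawTested : Prop :=
  ∃ η₀ : ℝ, 0 < η₀ ∧ ∀ (a₀ θ₀ : T3 → ℝ) (u₀ : T3 → V3), Continuous a₀ → Continuous θ₀ → Continuous u₀ →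
    (∀ x, 0 < a₀ x) → (∀ x, 0 < θ₀ x) → ∃ σ₀ : ℝ, 0 < σ₀ ∧ ∀ σ : ℝ, 0 < σ → σ < σ₀ →
    ∀ Φ : (N : ℕ) → HardSphereFlow G3 (hsDiameter σ N) (N + 1), ∀ τ : ℝ, 0 < τ →
    ∀ χ : ℝ × T3 → ℝ, Continuous χ → ∀ g : ℝ → ℝ, Continuous g → (∀ a, η₀ ≤ a → g a = 0) →
    ∀ η δ : ℝ, 0 < η → 0 < δ → ∃ r₀ : ℝ, 0 < r₀ ∧ ∀ r : ℝ, 0 < r → r < r₀ →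
    ∃ κ₀ : ℝ, 0 < κ₀ ∧ ∀ κ : ℝ, 0 < κ → κ < κ₀ → ∃ N₀ : ℕ, ∀ N : ℕ, N₀ ≤ N → ∀ k l : Fin 3,
      localGibbsLaw σ a₀ u₀ θ₀ N (Φ N)
        {z | η < |tubeTimeStat σ N (Φ N) τ χ g (XiP k l) r 1 1 κ z
              - enskogTerm σ N (Φ N) τ χ g (XiP k l) r z|}
        ≤ ENNReal.ofReal δ

/-- **S4 · STATIC CONTACT LAW — symmetry ⇒ Enskog's NUMBER** (`stub_staticContactLaw`; equilibrium statics plus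
local-limit bookkeeping, L–XL; the longest stub but with classical ingredients only).  Tested Palm invariance,
IsoChaos, micro-stationarity and density purity imply the tube law.  Proof plan (each step a `--supports` lemma):
(a) APPROXIMATION: the crux's continuous `χ, g` by smooth ones (uniformly; the unweighted tube statistic is
`O(1)` in probability by an a-priori collision/impulse bound — CollisionTightness stmt-13085 pattern); velocity
truncation of the unbounded mark `Ξ_P` by kinetic-energy tightness at contact (KineticEnergyTails stmt-13087 type,
see S5 for the frame caveat).  (b) LOCAL LIMITS: along subsequences the time–`χ`-averaged microscale empirical
fields around typical particles (marks `Λ`, probes `Γ`, velocity weights) converge to a random family of Palm-type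
laws `ν` on marked point configurations around a tagged particle; Palm + Micro + S1 pass to the limit as exact
identities: `E_ν[ψ(V₀) ∂_u Λ] = 0`, `E_ν[ψ(V₀) Σ_j ∂_a lam(ξ_j) V_j^a Π] = 0`, isotropy.  (c) NO ATOM at `V₀ = 0`:
the one-body velocity law of local limits has finite entropy relative to a Maxwellian (data-processing from
`H(LG_t | Gibbs) = H(LG_0 | Gibbs) = O(N)`, tree `klDiv` tools), so the weights `ψ(V)V^b` separate and (b) yields
UNWEIGHTED single-particle DLR: given the exterior (positions and velocities), the tagged position is uniform on
each path-component of its OPEN allowed cell (triage r1-1 (1)), and its speed is independent of where it sits.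
(d) CONNECTIVITY / LOCAL UNJAMMING at low density: at reduced density `< η₀` allowed configurations in a window are
a.s. connected through single-particle moves using the ambient vacant space (continuum-percolation statics,
Meester–Roy Ch. 3–4 type; to be PROVED — the one genuinely new static lemma, triage r1-2 (2), r1-3 (2)); with DLR
for every particle this makes the configuration uniform on allowed sets given particle numbers (canonical DLR) and
the velocity marks independent of the configuration.  (e) CANONICAL → GRAND CANONICAL: translation invariance of the
spatial `χ`-averages + canonical DLR ⇒ mixture of hard-sphere Gibbs processes `g_z` (Georgii 1979, canonical Gibbs
measures; GNZ/Papangelou characterisation, Nguyen–Zessin 1979); density pinned to `ρ_r(x)` and PURE by S6 ⇒ no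
mixture; `σ³ρ < η₀` small ⇒ unique `z(ρ)` with analytic pressure (Ruelle1969 §4.2, LebowitzPenrose1964 =
HsEosLowDensity stmt-0768).  (f) CONTACT THEOREM: the pair correlation of `g_{z(ρ)}` at contact is
`Y(ρσ³)ρ²`, isotropic, with `Y = (3/2π)F′` for HsEosLowDensity's analytic `F` on the OPEN band
(`deriv hsExcessFreeEnergy = deriv F` on `Ioo 0 η₀` from `EqOn … (Ico 0 η₀)`; never `Y 0`, Disproof §3/§5,
`Negative.ContactValueZero`; canonical finite-`N` version: tree `HardSphereCanonicalTorus.integral_two_point_eq`,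
card closure-invariance-principle's `(R0c)` as the flux/Palm identity, triage r1-3 hygiene).  (g) VELOCITIES AT
CONTACT: the two-body velocity law at contact is the configuration-independent bulk law (d); its cross-covariance
vanishes by S1 (`E[V_i ⊗ V_j μ(ξ_ij)] = E[RV_i ⊗ V_j μ] ∀R` ⇒ `0`: the instance `Θ = (·)^a`, `m = (·)^b`), its
one-body second moments are those of the `r`-ball law (`Σ_r`, S1 again for the frame), and the positive-part
halving `∫((w−v)·n̂)₊² = ½∫((w−v)·n̂)²` holds by exchange symmetry alone (Disproof §10 `Theta_XiP_eq_half`,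
`Bfun_eq_sum`; triage Check.lean `posPart_sq_swap_sum`): contact side `= Y ρ_r²(4π/15)(2Σ_r + trΣ_r·𝟙) =` Enskog
side, for EVERY one-body law (h-blindness — no Maxwellian is used anywhere).  (h) TUBE ↔ SHELL: the tube at flight
window `κε` reads the pair law on separations `1 < |ξ| < 1 + κ|V_i − V_j|`, which tends to the contact value as
`κ → 0` AFTER `N → ∞` at fixed `r` (continuity of `g₂(·; η)` at `1⁺` for the low-density Gibbs process; the
`κ ≪ φ` remark of triage r1-1 §F concerns reading `Y − 1 = O(φ)` at FIXED `κ` and is moot in this order).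
Why it might fail: (d) is unproved as stated (cages exist with positive probability at every density; the claim is
that at low density they are unjammable through the exterior, a.s.) — if false, component weights are free
invariant parameters and `Y` is determined only up to `O(η^k)` cage corrections; (b)'s local-limit extraction with
contact-scale resolution is XL bookkeeping (the finite-`N` tube makes it an equal-time statement, no trace theorem
needed); frame: the a-priori tails of (a) are typed in the Euler-solution frame in the route (R2).  Size L–XL.
Leans on: `PalmInvarianceTested`, S1, S2, S6; tree `tubeStat`/`tubeTimeStat`/`abs_tubeStat_le`
(CollisionTubeFunctional), `HardSphereCanonicalTorus.integral_two_point_eq`, `hsExcessFreeEnergy`,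
`hsCompressibility`, `HardCoreCanonical`/`HardSphereGibbs` (StatisticalMechanics), `InfiniteHardSphereFlow` NOT used
(finite-`N` chain, triage r1-3 (3)); route supports HsEosLowDensity (stmt-0768), CollisionTightness (13085),
KineticEnergyTails (13087); Disproof §10 lemmas; Georgii1979 (LNM 760), NguyenZessin1979, MeesterRoy1996,
Ruelle1969, LebowitzPenrose1964, GenoveseSimonella2012 §4–5 (what direct integration does NOT give). -/
def Stubs.stub_staticContactLaw : Prop :=
  PalmInvarianceTested → Stubs.stub_isoChaos → Stubs.stub_microStationarity →
    Stubs.stub_densityCompactness → TubeLawTested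

/-- Registered stub S4 (`Stubs.stub_staticContactLaw`, hypotheses by name, conclusion verbatim `TubeLawTested`):
the `sorry` to be discharged. -/
theorem stub_staticContactLaw (hPalm : PalmInvarianceTested) (hIso : Stubs.stub_isoChaos)
    (hMicro : Stubs.stub_microStationarity) (hCpt : Stubs.stub_densityCompactness) :
  ∃ η₀ : ℝ, 0 < η₀ ∧ ∀ (a₀ θ₀ : T3 → ℝ) (u₀ : T3 → V3), Continuous a₀ → Continuous θ₀ → Continuous u₀ →
    (∀ x, 0 < a₀ x) → (∀ x, 0 < θ₀ x) → ∃ σ₀ : ℝ, 0 < σ₀ ∧ ∀ σ : ℝ, 0 < σ → σ < σ₀ →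
    ∀ Φ : (N : ℕ) → HardSphereFlow G3 (hsDiameter σ N) (N + 1), ∀ τ : ℝ, 0 < τ →
    ∀ χ : ℝ × T3 → ℝ, Continuous χ → ∀ g : ℝ → ℝ, Continuous g → (∀ a, η₀ ≤ a → g a = 0) →
    ∀ η δ : ℝ, 0 < η → 0 < δ → ∃ r₀ : ℝ, 0 < r₀ ∧ ∀ r : ℝ, 0 < r → r < r₀ →
    ∃ κ₀ : ℝ, 0 < κ₀ ∧ ∀ κ : ℝ, 0 < κ → κ < κ₀ → ∃ N₀ : ℕ, ∀ N : ℕ, N₀ ≤ N → ∀ k l : Fin 3,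
      localGibbsLaw σ a₀ u₀ θ₀ N (Φ N)
        {z | η < |tubeTimeStat σ N (Φ N) τ χ g (XiP k l) r 1 1 κ z
              - enskogTerm σ N (Φ N) τ χ g (XiP k l) r z|}
        ≤ ENNReal.ofReal δ := by
  sorry

/-- **S5 · CYLINDER PULL-BACK for the even marks** (`stub_tubePullback`; parity-free, isotropy-free BOOKKEEPING
shared with crux 13078: it is `Stubs.stub_cylinderPullback` of `Lines/equilibrium-rung-mean-variance.lean` read
at truncation level `L = 1` — where the reweighting `min(1 + e^{−F}, 1)` is identically `1`, so `ϑ` is inert and the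
13078 lead's `e^{−F}`-tightness warning does not touch it — with the bounded odd mark replaced by the crux's
UNBOUNDED even mark `Ξ_P^{kl}`).  Same frame as the crux, `∀η δ ∃r₀ ∀r<r₀ ∃κ₀ ∀κ<κ₀ ∃N₀ ∀N≥N₀ ∀k l`:
`P_LG( |K_N[χ g Ξ_P^{kl}] − tubeTimeStat(Ξ_P^{kl}; r, 1, 1, κ)| > η ) ≤ δ`.  Why plausibly true: on the good set
every collision at time `s` whose partners flew freely during `[s − κε, s]` is seen by the tube functional for
exactly `t ∈ [s − κε, s)` with the correct `(n̂, v⁻, w⁻)` and contributes `κε·((N+1)κ)⁻¹ = ε/(N+1)` times its mark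
— the PATHWISE identity `K_N = T_κ + R_κ + B + C` with short flights `R_κ` (a third body within reach during `κε`:
fraction `O(κσ³ρ)` of the impulse, in probability), time boundary `B` (`O(κε/τ)`) and continuity corrections `C`
(`χ`, `g∘ρ_r` read at `t, x_i(t)` instead of `s, x_i(s)`: displacements `≤ |v|κε`) — all `→ 0` as `N → ∞` then
`κ → 0`; the ONLY addition to the 13078 version is that the mark `((w−v)·n̂)₊ n̂_kn̂_l` is unbounded, so each error
term is an IMPULSE-weighted (not count-weighted) fraction and needs tightness of the collision-averaged relative
speed: `K_N[((w−v)·n̂)₊ 1_{|v|+|w| > A}] → 0` uniformly in `N` as `A → ∞`.  Why it might fail / frame caveat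
(triage R2): that tail input is KineticEnergyTails-type; the route types stmt-13087 in the Euler-solution frame
(`t < T`), whereas the crux — hence this stub — is in the bare local-Gibbs frame `∀τ`; entropy relative to the
invariant Gibbs law bounds the tail impulse but does not make it vanish, so for `∀τ` an LG-frame tail statement is
a genuine (mild) extra input, shared by every line of this crux.  Size L.  Leans on: tree `oddStatTrunc`,
`tubeStat`, `tubeTimeStat`, `abs_tubeStat_le` (CollisionTubeFunctional), `IsHardSphereTrajectory.{free, binary,
locFinite, eq_freeFlight}`, `freeFlight_apply`, `Torus.geometry_sepVec`, `reflectVel_reflectVel`,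
`inner_reflectVel_fst_sub_snd`, `HardSphereFlow.{isTrajectory, mapsTo_good, flow_add}`,
`collisionalVirial_eq_collisionalStress` (impulse bookkeeping), `localGibbsLaw_compl_good`; route supports
CollisionTightness (13085), EmpiricalEnskogIdentity (13086), KineticEnergyTails (13087); 13078's
`Lines/equilibrium-rung-mean-variance.lean` S2 workers; GST2013 §4.1, CIP1994 §2.2. -/
def Stubs.stub_tubePullback : Prop :=
  ∃ η₀ : ℝ, 0 < η₀ ∧ ∀ (a₀ θ₀ : T3 → ℝ) (u₀ : T3 → V3), Continuous a₀ → Continuous θ₀ → Continuous u₀ →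
    (∀ x, 0 < a₀ x) → (∀ x, 0 < θ₀ x) → ∃ σ₀ : ℝ, 0 < σ₀ ∧ ∀ σ : ℝ, 0 < σ → σ < σ₀ →
    ∀ Φ : (N : ℕ) → HardSphereFlow G3 (hsDiameter σ N) (N + 1), ∀ τ : ℝ, 0 < τ →
    ∀ χ : ℝ × T3 → ℝ, Continuous χ → ∀ g : ℝ → ℝ, Continuous g → (∀ a, η₀ ≤ a → g a = 0) →
    ∀ η δ : ℝ, 0 < η → 0 < δ → ∃ r₀ : ℝ, 0 < r₀ ∧ ∀ r : ℝ, 0 < r → r < r₀ →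
    ∃ κ₀ : ℝ, 0 < κ₀ ∧ ∀ κ : ℝ, 0 < κ → κ < κ₀ → ∃ N₀ : ℕ, ∀ N : ℕ, N₀ ≤ N → ∀ k l : Fin 3,
      localGibbsLaw σ a₀ u₀ θ₀ N (Φ N)
        {z | η < |collStat σ N (Φ N) τ χ g (XiP k l) r z
              - tubeTimeStat σ N (Φ N) τ χ g (XiP k l) r 1 1 κ z|}
        ≤ ENNReal.ofReal δ

/-- Registered stub S5 (`Stubs.stub_tubePullback`, verbatim): the `sorry` to be discharged. -/
theorem stub_tubePullback :
  ∃ η₀ : ℝ, 0 < η₀ ∧ ∀ (a₀ θ₀ : T3 → ℝ) (u₀ : T3 → V3), Continuous a₀ → Continuous θ₀ → Continuous u₀ →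
    (∀ x, 0 < a₀ x) → (∀ x, 0 < θ₀ x) → ∃ σ₀ : ℝ, 0 < σ₀ ∧ ∀ σ : ℝ, 0 < σ → σ < σ₀ →
    ∀ Φ : (N : ℕ) → HardSphereFlow G3 (hsDiameter σ N) (N + 1), ∀ τ : ℝ, 0 < τ →
    ∀ χ : ℝ × T3 → ℝ, Continuous χ → ∀ g : ℝ → ℝ, Continuous g → (∀ a, η₀ ≤ a → g a = 0) →
    ∀ η δ : ℝ, 0 < η → 0 < δ → ∃ r₀ : ℝ, 0 < r₀ ∧ ∀ r : ℝ, 0 < r → r < r₀ →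
    ∃ κ₀ : ℝ, 0 < κ₀ ∧ ∀ κ : ℝ, 0 < κ → κ < κ₀ → ∃ N₀ : ℕ, ∀ N : ℕ, N₀ ≤ N → ∀ k l : Fin 3,
      localGibbsLaw σ a₀ u₀ θ₀ N (Φ N)
        {z | η < |collStat σ N (Φ N) τ χ g (XiP k l) r z
              - tubeTimeStat σ N (Φ N) τ χ g (XiP k l) r 1 1 κ z|}
        ≤ ENNReal.ofReal δ := by
  sorry

/-! ## §4 The composition (kernel-checked, sorry-free) -/

/-- **`EvenStressEnskog` from S1–S6.**  `hP := S3 S1 S2` (tested DLR), `hT := S4 hP S1 S2 S6` (tube law); then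
the crux, in its named form (`evenStressEnskog_iff`), from the tube law and the pull-back S5 by the union bound
`{η < |K − E|} ⊆ {η/2 < |K − T|} ∪ {η/2 < |T − E|}`: thresholds `η₀, σ₀, r₀ := min` (a cutoff vanishing on
`[min, ∞)` vanishes on each `[ηᵢ, ∞)`), both inputs run at `(η/2, δ/2)`, `κ := min(κ₀⁴, κ₀⁵)/2`, `N₀ := max`,
`measure_union_le` and `ENNReal.ofReal_add`. [folklore] -/
theorem EvenStressEnskog_of
    (h1 : Stubs.stub_isoChaos) (h2 : Stubs.stub_microStationarity) (h3 : Stubs.stub_palmInvariance_of)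
    (h4 : Stubs.stub_staticContactLaw) (h5 : Stubs.stub_tubePullback)
    (h6 : Stubs.stub_densityCompactness) : EvenStressEnskog := by
  have hP : PalmInvarianceTested := h3 h1 h2
  have hT : TubeLawTested := h4 hP h1 h2 h6
  refine evenStressEnskog_iff.2 ?_
  obtain ⟨η₄, hη₄, H4⟩ := hT
  obtain ⟨η₅, hη₅, H5⟩ := h5
  refine ⟨min η₄ η₅, lt_min hη₄ hη₅, ?_⟩
  intro a₀ θ₀ u₀ ha hθ hu ha0 hθ0
  obtain ⟨σ₄, hσ₄, H4⟩ := H4 a₀ θ₀ u₀ ha hθ hu ha0 hθ0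
  obtain ⟨σ₅, hσ₅, H5⟩ := H5 a₀ θ₀ u₀ ha hθ hu ha0 hθ0
  refine ⟨min σ₄ σ₅, lt_min hσ₄ hσ₅, ?_⟩
  intro σ hσ hσlt Φ τ hτ χ hχ g hg hg0 η δ hη hδ
  have hσ4 : σ < σ₄ := lt_of_lt_of_le hσlt (min_le_left _ _)
  have hσ5 : σ < σ₅ := lt_of_lt_of_le hσlt (min_le_right _ _)
  have hg4 : ∀ a, η₄ ≤ a → g a = 0 := fun a h => hg0 a ((min_le_left _ _).trans h)
  have hg5 : ∀ a, η₅ ≤ a → g a = 0 := fun a h => hg0 a ((min_le_right _ _).trans h)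
  have hη2 : 0 < η / 2 := by positivity
  have hδ2 : 0 < δ / 2 := by positivity
  obtain ⟨r₄, hr₄, H4⟩ := H4 σ hσ hσ4 Φ τ hτ χ hχ g hg hg4 (η / 2) (δ / 2) hη2 hδ2
  obtain ⟨r₅, hr₅, H5⟩ := H5 σ hσ hσ5 Φ τ hτ χ hχ g hg hg5 (η / 2) (δ / 2) hη2 hδ2
  refine ⟨min r₄ r₅, lt_min hr₄ hr₅, ?_⟩
  intro r hr hrlt
  have hr4 : r < r₄ := lt_of_lt_of_le hrlt (min_le_left _ _)
  have hr5 : r < r₅ := lt_of_lt_of_le hrlt (min_le_right _ _)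
  obtain ⟨κ₄, hκ₄, H4⟩ := H4 r hr hr4
  obtain ⟨κ₅, hκ₅, H5⟩ := H5 r hr hr5
  have hκpos : (0 : ℝ) < min κ₄ κ₅ / 2 := by positivity
  have hκ4 : min κ₄ κ₅ / 2 < κ₄ := by
    have := min_le_left κ₄ κ₅
    linarith
  have hκ5 : min κ₄ κ₅ / 2 < κ₅ := by
    have := min_le_right κ₄ κ₅
    linarith
  obtain ⟨N₄, H4⟩ := H4 (min κ₄ κ₅ / 2) hκpos hκ4
  obtain ⟨N₅, H5⟩ := H5 (min κ₄ κ₅ / 2) hκpos hκ5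
  refine ⟨max N₄ N₅, fun N hN k l => ?_⟩
  have E4 := H4 N ((le_max_left _ _).trans hN) k l
  have E5 := H5 N ((le_max_right _ _).trans hN) k l
  set P := localGibbsLaw σ a₀ u₀ θ₀ N (Φ N) with hP'
  set K := fun z => collStat σ N (Φ N) τ χ g (XiP k l) r z with hK
  set T := fun z => tubeTimeStat σ N (Φ N) τ χ g (XiP k l) r 1 1 (min κ₄ κ₅ / 2) z with hT'
  set E := fun z => enskogTerm σ N (Φ N) τ χ g (XiP k l) r z with hE
  have hsub : {z | η < |K z - E z|} ⊆ {z | η / 2 < |K z - T z|} ∪ {z | η / 2 < |T z - E z|} := by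
    intro z hz
    simp only [Set.mem_setOf_eq, Set.mem_union] at hz ⊢
    by_contra hcon
    simp only [not_or, not_lt] at hcon
    obtain ⟨h1', h2'⟩ := hcon
    have : |K z - E z| ≤ |K z - T z| + |T z - E z| := abs_sub_le (K z) (T z) (E z)
    linarith
  calc P {z | η < |K z - E z|}
      ≤ P ({z | η / 2 < |K z - T z|} ∪ {z | η / 2 < |T z - E z|}) := measure_mono hsub
    _ ≤ P {z | η / 2 < |K z - T z|} + P {z | η / 2 < |T z - E z|} := measure_union_le _ _
    _ ≤ ENNReal.ofReal (δ / 2) + ENNReal.ofReal (δ / 2) := add_le_add E5 E4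
    _ = ENNReal.ofReal δ := by
        rw [← ENNReal.ofReal_add hδ2.le hδ2.le]
        congr 1
        ring

/-- **The skeleton IS the crux proof modulo the registered stubs** (D-0027 §3.3 shape
`theorem <Crux>_proof : <crux decl> := <line>._of stub₁ … stub₆`): sorry-free itself; its only gaps are the six
`stub_*` theorems above, matched against the statement `Prop`s `Stubs.stub_*` by `rfl`-unfolding. [folklore] -/
theorem EvenStressEnskog_proof : EvenStressEnskog :=
  EvenStressEnskog_of stub_isoChaos stub_microStationarity stub_palmInvariance_of
    stub_staticContactLaw stub_tubePullback stub_densityCompactness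

end Summit.AtomisticToContinuum.HydrodynamicLimit.Cruxes.EvenStressEnskog.RotateFlyCommutatorDlr

end
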